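import Literature.Probability.Percolation.PlanarDuality

/-!
# `SelfDuality` of route `CardyWickAnisotropy` (stmt-CriticalPhenomena-10259) — bookkeeping and box geometry

Helper file (`--supports stmt-CriticalPhenomena-10259`) for
`Summit.CriticalPhenomena.CardyFormulaZ2.Theses.CardyWickAnisotropy.SelfDuality`
(`V_n(p) + V_n(1 - p) = 1` for the complex-anisotropy crossing amplitude of the box
`R_n = [0, n + 1] × [0, n]`), closed in `CardyWickAnisotropySelfDuality.lean`:

* `sum_ite_prod_add_of_involution` — the abstract bookkeeping: if `τ` is an involution of the
  finite edge set `E` preserving the horizontal/vertical type and the configuration involution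
  `Φ ω = {e ∈ E | τ e ∉ ω}` exchanges the event `A` with its complement, then
  `V(p) + V(1 - p) = Σ_ω Π_e (w + (1 - w)) = 1` (`Finset.prod_add`, reindexing by `Φ`);
* the edges of `R_n` in coordinates (`mem_boxEdges_iff`) and the edge map `τ` = "dual edge, then
  the quarter turn `ψ (x₀, x₁) = (x₁ + 1, x₀)` carrying the dual rectangle `[0, n] × [-1, n]` onto
  `R_n`" on the edges whose dual lies in the dual rectangle, identity on the `2n` vertical edges of
  the two boundary columns; `tau_spec`: it is a type-preserving involution of `E(R_n)`.

All auxiliary objects (`E`, `ψ`, `τ`, the weights) are variables with characterising hypotheses;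
the file declares no definitions. Sources: Bollobás–Riordan, *Percolation* (2006), Ch. 3, Lemma 1
and Corollary 3; Grimmett, *Percolation* (1999), §11.2, Lemma 11.21.
-/

noncomputable section

open Literature.Probability.Percolation
open Literature.Probability.LatticeModels

namespace Summit.CriticalPhenomena.CardyFormulaZ2.Theorems.CardyWickAnisotropy

/-! ### Abstract bookkeeping: an involution exchanging an event with its complement -/

/-- **Abstract self-duality.** Let `τ` be an involution of the finite set `E` preserving the
predicate `hor`, let `w q e = q` if `hor e` and `1 - q` otherwise, and suppose the configuration
map `ω ↦ {e ∈ E | τ e ∉ ω}` carries the event `A` onto its complement (on `ω ⊆ E`). Then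
`V q = Σ_{ω ⊆ E} 1[A ω] Π_{e ∈ E} (w q e if e ∈ ω else 1 - w q e)` satisfies `V p + V (1 - p) = 1`:
reindexing the second sum by the involution turns it into the sum over the complement of `A` with
the weights of `p`, and the total mass is `Π_e (w + (1 - w)) = 1` (`Finset.prod_add`).
(Bollobás–Riordan 2006, Ch. 3, proof of Corollary 3, abstract form.) -/
theorem sum_ite_prod_add_of_involution {α R : Type*} [DecidableEq α] [CommRing R]
    (E : Finset α) (τ : α → α) (hτE : ∀ e ∈ E, τ e ∈ E) (hττ : ∀ e ∈ E, τ (τ e) = e)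
    (hor : α → Prop) [DecidablePred hor] (hhor : ∀ e ∈ E, hor (τ e) ↔ hor e)
    (A : Finset α → Prop) [DecidablePred A]
    (hA : ∀ ω, ω ⊆ E → (A (E.filter fun e => τ e ∉ ω) ↔ ¬ A ω))
    (w : R → α → R) (hw : ∀ q e, w q e = if hor e then q else 1 - q)
    (V : R → R) (hV : ∀ q, V q = ∑ ω ∈ E.powerset,
      if A ω then ∏ e ∈ E, (if e ∈ ω then w q e else 1 - w q e) else 0)
    (p : R) : V p + V (1 - p) = 1 := by
  -- total mass
  have htotal : ∑ ω ∈ E.powerset, ∏ e ∈ E, (if e ∈ ω then w p e else 1 - w p e) = 1 := by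
    have h1 : ∏ e ∈ E, (w p e + (1 - w p e)) = 1 := Finset.prod_eq_one fun e _ => by ring
    rw [Finset.prod_add] at h1
    refine Eq.trans (Finset.sum_congr rfl fun ω hω => ?_) h1
    rw [Finset.mem_powerset] at hω
    rw [← Finset.prod_sdiff hω, mul_comm]
    congr 1
    · exact Finset.prod_congr rfl fun e he => if_pos he
    · exact Finset.prod_congr rfl fun e he => if_neg (Finset.mem_sdiff.1 he).2
  -- the configuration involution
  have hΦE : ∀ ω : Finset α, (E.filter fun e => τ e ∉ ω) ⊆ E := fun ω => Finset.filter_subset _ _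
  have hΦΦ : ∀ ω, ω ⊆ E → (E.filter fun e => τ e ∉ E.filter fun e' => τ e' ∉ ω) = ω := by
    intro ω hω
    ext e
    simp only [Finset.mem_filter, not_and, not_not]
    constructor
    · rintro ⟨he, h⟩
      simpa only [hττ e he] using h (hτE e he)
    · intro he
      exact ⟨hω he, fun _ => by rwa [hττ e (hω he)]⟩
  -- the weights match after `p ↔ 1 - p`
  have hweight : ∀ ω : Finset α,
      ∏ e ∈ E, (if e ∈ E.filter (fun e => τ e ∉ ω) then w (1 - p) e else 1 - w (1 - p) e) =
        ∏ e ∈ E, (if e ∈ ω then w p e else 1 - w p e) := by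
    intro ω
    refine Finset.prod_nbij' τ τ hτE hτE hττ hττ fun e he => ?_
    have hh := hhor e he
    simp only [Finset.mem_filter, he, true_and, hw]
    by_cases h1 : hor e <;> by_cases h2 : τ e ∈ ω <;> simp only [h1, h2, hh] <;> simp
  -- reindex the second sum
  have hV' : (∑ ω ∈ E.powerset,
      if ¬ A ω then ∏ e ∈ E, (if e ∈ ω then w p e else 1 - w p e) else 0) = V (1 - p) := by
    rw [hV]
    refine Finset.sum_nbij' (fun ω => E.filter fun e => τ e ∉ ω) (fun ω => E.filter fun e => τ e ∉ ω)
      (fun ω _ => Finset.mem_powerset.2 (hΦE ω)) (fun ω _ => Finset.mem_powerset.2 (hΦE ω))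
      (fun ω hω => hΦΦ ω (Finset.mem_powerset.1 hω)) (fun ω hω => hΦΦ ω (Finset.mem_powerset.1 hω))
      fun ω hω => ?_
    rw [hweight ω]
    by_cases h : A ω <;> simp [h, hA ω (Finset.mem_powerset.1 hω)]
  rw [← hV', hV, ← Finset.sum_add_distrib]
  refine Eq.trans (Finset.sum_congr rfl fun ω _ => ?_) htotal
  by_cases h : A ω <;> simp [h]

/-! ### Coordinates: the edges of the box and their duals -/

/-- `hor s(x, y) ↔ x₁ = y₁` for the route's horizontality predicate
`∃ x y, e = s(x, y) ∧ x 1 = y 1`. -/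
theorem exists_eq_mk_and_iff (x y : Site 2) :
    (∃ a b : Site 2, s(x, y) = s(a, b) ∧ a 1 = b 1) ↔ x 1 = y 1 := by
  constructor
  · rintro ⟨a, b, h, hab⟩
    rcases Sym2.eq_iff.1 h with ⟨rfl, rfl⟩ | ⟨rfl, rfl⟩
    · exact hab
    · exact hab.symm
  · intro h
    exact ⟨x, y, rfl, h⟩

/-- The edges of `ℤ²` with both endpoints in `[0, n + 1] × [0, n]`, in coordinates: the horizontal
edges `{u, u + e₀}` with `0 ≤ u₀ ≤ n`, `0 ≤ u₁ ≤ n` and the vertical edges `{u, u + e₁}` with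
`0 ≤ u₀ ≤ n + 1`, `0 ≤ u₁ ≤ n - 1`. -/
theorem mem_boxEdges_iff (n : ℕ) (E : Finset (Sym2 (Site 2)))
    (hE : ∀ e, e ∈ E ↔ e ∈ (zdGraph 2).edgeSet ∧ ∀ z ∈ e, z ∈ rectangle (n + 1) n)
    (e : Sym2 (Site 2)) :
    e ∈ E ↔
      (∃ u : Site 2, e = s(u, u + Pi.single 0 1) ∧ 0 ≤ u 0 ∧ u 0 + 1 ≤ n + 1 ∧ 0 ≤ u 1 ∧ u 1 ≤ n) ∨
      (∃ u : Site 2, e = s(u, u + Pi.single 1 1) ∧ 0 ≤ u 0 ∧ u 0 ≤ n + 1 ∧ 0 ≤ u 1 ∧ u 1 + 1 ≤ n) := by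
  rw [hE]
  constructor
  · rintro ⟨he, hR⟩
    obtain ⟨u, i, rfl⟩ := mem_edgeSet_zdGraph_iff.1 he
    have hu := hR u (Sym2.mem_mk_left _ _)
    have hv := hR (u + Pi.single i 1) (Sym2.mem_mk_right _ _)
    rw [mem_rectangle_iff] at hu hv
    fin_cases i
    · left
      refine ⟨u, rfl, ?_⟩
      simp only [Fin.zero_eta, Pi.add_apply, single_zero_apply_zero, single_zero_apply_one] at hv
      push_cast at hu hv ⊢
      omega
    · right
      refine ⟨u, rfl, ?_⟩
      simp only [Fin.mk_one, Pi.add_apply, single_one_apply_zero, single_one_apply_one] at hv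
      push_cast at hu hv ⊢
      omega
  · rintro (⟨u, rfl, hu⟩ | ⟨u, rfl, hu⟩)
    · refine ⟨single_edge_mem u 0, fun z hz => ?_⟩
      rcases Sym2.mem_iff.1 hz with rfl | rfl
      · rw [mem_rectangle_iff]; push_cast; omega
      · rw [mem_rectangle_iff]
        simp only [Pi.add_apply, single_zero_apply_zero, single_zero_apply_one]
        push_cast; omega
    · refine ⟨single_edge_mem u 1, fun z hz => ?_⟩
      rcases Sym2.mem_iff.1 hz with rfl | rfl
      · rw [mem_rectangle_iff]; push_cast; omega
      · rw [mem_rectangle_iff]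
        simp only [Pi.add_apply, single_one_apply_zero, single_one_apply_one]
        push_cast; omega

/-- The dual of a horizontal edge of the box lies in the dual rectangle `[0, n] × [-1, n]`. -/
theorem dualEdge_horizontal_mem_sym2 (n : ℕ) (u : Site 2)
    (hu : 0 ≤ u 0 ∧ u 0 + 1 ≤ n + 1 ∧ 0 ≤ u 1 ∧ u 1 ≤ n) :
    dualEdge s(u, u + Pi.single 0 1) ∈ (dualRectangle (n + 1) n).sym2 := by
  rw [dualEdge_horizontal, Finset.mk_mem_sym2_iff, mem_dualRectangle_iff, mem_dualRectangle_iff]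
  simp only [Pi.sub_apply, single_one_apply_zero, single_one_apply_one]
  push_cast
  omega

/-- The dual of a vertical edge `{u, u + e₁}` of the box lies in the dual rectangle iff the edge is
not in one of the two boundary columns: `1 ≤ u₀ ≤ n`. -/
theorem dualEdge_vertical_mem_sym2_iff (n : ℕ) (u : Site 2) (hu : 0 ≤ u 1 ∧ u 1 + 1 ≤ n) :
    dualEdge s(u, u + Pi.single 1 1) ∈ (dualRectangle (n + 1) n).sym2 ↔ 1 ≤ u 0 ∧ u 0 ≤ n := by
  rw [dualEdge_vertical, Finset.mk_mem_sym2_iff, mem_dualRectangle_iff, mem_dualRectangle_iff]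
  simp only [Pi.sub_apply, single_zero_apply_zero, single_zero_apply_one]
  push_cast
  omega

/-! ### The edge involution `τ` -/

section Tau

variable (n : ℕ) (ψ : Site 2 ≃ Site 2) (hψ0 : ∀ x, ψ x 0 = x 1 + 1) (hψ1 : ∀ x, ψ x 1 = x 0)
  (τ : Sym2 (Site 2) → Sym2 (Site 2))
  (hτ : ∀ e, τ e = if dualEdge e ∈ (dualRectangle (n + 1) n).sym2 then Sym2.map ψ (dualEdge e) else e)

include hψ0 hψ1 hτ in
/-- `τ` on a horizontal edge `{u, u + e₀}` of the box is the horizontal edge `{ū, ū + e₀}`,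
`ū = (u₁, u₀)`. -/
theorem tau_horizontal (u : Site 2) (hu : 0 ≤ u 0 ∧ u 0 + 1 ≤ n + 1 ∧ 0 ≤ u 1 ∧ u 1 ≤ n) :
    τ s(u, u + Pi.single 0 1) = s(![u 1, u 0], ![u 1, u 0] + Pi.single 0 1) := by
  rw [hτ, if_pos (dualEdge_horizontal_mem_sym2 n u hu), dualEdge_horizontal, Sym2.map_mk]
  congr 1 <;> rw [Site.eq_iff_two] <;> simp [hψ0, hψ1]

include hψ0 hψ1 hτ in
/-- `τ` on an interior vertical edge `{u, u + e₁}` (`1 ≤ u₀ ≤ n`) is the interior vertical edge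
`{v, v + e₁}`, `v = (u₁ + 1, u₀ - 1)`. -/
theorem tau_vertical (u : Site 2) (hu : 1 ≤ u 0 ∧ u 0 ≤ n ∧ 0 ≤ u 1 ∧ u 1 + 1 ≤ n) :
    τ s(u, u + Pi.single 1 1) = s(![u 1 + 1, u 0 - 1], ![u 1 + 1, u 0 - 1] + Pi.single 1 1) := by
  rw [hτ, if_pos ((dualEdge_vertical_mem_sym2_iff n u ⟨hu.2.2.1, hu.2.2.2⟩).2 ⟨hu.1, hu.2.1⟩),
    dualEdge_vertical, Sym2.map_mk]
  congr 1 <;> rw [Site.eq_iff_two] <;> simp [hψ0, hψ1]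

include hτ in
/-- `τ` fixes the vertical edges of the two boundary columns. -/
theorem tau_vertical_side (u : Site 2) (hu : 0 ≤ u 1 ∧ u 1 + 1 ≤ n) (hside : ¬ (1 ≤ u 0 ∧ u 0 ≤ n)) :
    τ s(u, u + Pi.single 1 1) = s(u, u + Pi.single 1 1) := by
  rw [hτ, if_neg (mt (dualEdge_vertical_mem_sym2_iff n u hu).1 hside)]

include hψ0 hψ1 hτ in
/-- **`τ` is a type-preserving involution of the edges of the box**, and it preserves the set of
edges whose dual lies in the dual rectangle. -/
theorem tau_spec (E : Finset (Sym2 (Site 2)))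
    (hE : ∀ e, e ∈ E ↔ e ∈ (zdGraph 2).edgeSet ∧ ∀ z ∈ e, z ∈ rectangle (n + 1) n)
    (hor : Sym2 (Site 2) → Prop) (hhor : ∀ x y, hor s(x, y) ↔ x 1 = y 1) (e : Sym2 (Site 2)) (he : e ∈ E) :
    τ e ∈ E ∧ τ (τ e) = e ∧ (hor (τ e) ↔ hor e) ∧
      (dualEdge e ∈ (dualRectangle (n + 1) n).sym2 → dualEdge (τ e) ∈ (dualRectangle (n + 1) n).sym2) := by
  rcases (mem_boxEdges_iff n E hE e).1 he with ⟨u, rfl, hu⟩ | ⟨u, rfl, hu⟩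
  · -- horizontal edge
    have hu' : 0 ≤ (![u 1, u 0] : Site 2) 0 ∧ (![u 1, u 0] : Site 2) 0 + 1 ≤ n + 1 ∧
        0 ≤ (![u 1, u 0] : Site 2) 1 ∧ (![u 1, u 0] : Site 2) 1 ≤ n := by
      simp only [Matrix.cons_val_zero, Matrix.cons_val_one]; omega
    have h1 := tau_horizontal n ψ hψ0 hψ1 τ hτ u hu
    have h2 := tau_horizontal n ψ hψ0 hψ1 τ hτ _ hu'
    rw [h1]
    refine ⟨(mem_boxEdges_iff n E hE _).2 (Or.inl ⟨_, rfl, hu'⟩), ?_, ?_, fun _ =>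
      dualEdge_horizontal_mem_sym2 n _ hu'⟩
    · rw [h2]
      congr 1 <;> rw [Site.eq_iff_two] <;> simp
    · rw [hhor, hhor]
      simp
  · -- vertical edge
    by_cases hmid : 1 ≤ u 0 ∧ u 0 ≤ n
    · have hum : 1 ≤ u 0 ∧ u 0 ≤ n ∧ 0 ≤ u 1 ∧ u 1 + 1 ≤ n := ⟨hmid.1, hmid.2, hu.2.2.1, hu.2.2.2⟩
      have hv : 1 ≤ (![u 1 + 1, u 0 - 1] : Site 2) 0 ∧ (![u 1 + 1, u 0 - 1] : Site 2) 0 ≤ n ∧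
          0 ≤ (![u 1 + 1, u 0 - 1] : Site 2) 1 ∧ (![u 1 + 1, u 0 - 1] : Site 2) 1 + 1 ≤ n := by
        simp only [Matrix.cons_val_zero, Matrix.cons_val_one]; omega
      have h1 := tau_vertical n ψ hψ0 hψ1 τ hτ u hum
      have h2 := tau_vertical n ψ hψ0 hψ1 τ hτ _ hv
      rw [h1]
      refine ⟨(mem_boxEdges_iff n E hE _).2 (Or.inr ⟨_, rfl, by omega, by omega, hv.2.2.1, hv.2.2.2⟩),
        ?_, ?_, fun _ => (dualEdge_vertical_mem_sym2_iff n _ ⟨hv.2.2.1, hv.2.2.2⟩).2 ⟨hv.1, hv.2.1⟩⟩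
      · rw [h2]
        congr 1 <;> rw [Site.eq_iff_two] <;> simp
      · rw [hhor, hhor]
        simp
    · have h1 := tau_vertical_side n ψ τ hτ u ⟨hu.2.2.1, hu.2.2.2⟩ hmid
      rw [h1, h1]
      exact ⟨he, rfl, Iff.rfl, fun hd =>
        absurd ((dualEdge_vertical_mem_sym2_iff n u ⟨hu.2.2.1, hu.2.2.2⟩).1 hd) hmid⟩

end Tau

end Summit.CriticalPhenomena.CardyFormulaZ2.Theorems.CardyWickAnisotropy
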